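import Summits.Ventures.PercRepro.ProfileGapMonoHardRow
import Summits.Ventures.PercRepro.ProfileGapMonoColoopRegime

/-!
# PercRepro — THE HARD RULE IN IH-AWARE ROW FORM, AND THE COLOOP DISPATCH (p5, gen 22; announced INBOX 10525;
on p10's ProfileGapMonoHardRow and p5's ProfileGapMonoColoopRegime)

`c025_of_hardRowQ''` (p10) asks for the co-rank-`q` row on the HARD CLASS — simple matroids on `≥ u + q + 1`
elements of rank `> u` with no `q`-generic point, `3 ≤ q < u` — as a black box.  The strong induction on `#E`
that consumes it has, at that moment, EVERY row of EVERY matroid on fewer elements; `HardRowIH` exposes that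
induction hypothesis, so a proof of the row on the hard class may use the rows of the minors of `N`.  The
induction is p10's (`profileIneqMinusQ_of_hardRowQ''_aux`) with the hypothesis passed through.

THE COLOOP DISPATCH.  With the IH in hand, a hard matroid with a coloop `z` at the top-but-one level
(`ρ(N ∖ z) = u`) or in the regime `ρ(N ∖ z) ≥ u + q` gets its row from the rows of `N ∖ z`
(`profileIneqMinusQ_of_coloop_top_but_one` / `profileIneqMinusQ_of_coloop_regime`), so the hard class shrinks to
the matroids in which every coloop `z` has `u + 1 ≤ ρ(N ∖ z) ≤ u + q − 1` (`HardRowIHBand`); at the first open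
level `u = ρ(E) − 1` this is the COLOOP-FREE hard class.

* `HardRowIH`, `profileIneqMinusQ_of_hardRowIH_aux`, **`profileIneqMinusQ_of_hardRowIH`**, `profileIneq_of_hardRowIH`,
  `hardRowIH_of_hardRowQ''`, `c025Profile_of_hardRowIH`, **`c025_of_hardRowIH`**;
* `HardRowIHBand`, **`hardRowIH_of_band`**, **`c025_of_hardRowIHBand`**.
-/

open scoped Matroid

namespace PercRepro.Cogirth

open Finset ThmH Skew Shadow Profile

variable {α : Type} [DecidableEq α] {M : Matroid α} [M.Finite]

/-- **The hard rule in row form, with the induction hypothesis**: the co-rank-`q` row on every simple matroid on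
at least `u + q + 1` elements of rank `> u` in which every point lies on a cocircuit of rank `≤ q`, for
`3 ≤ q < u`, GIVEN every co-rank row of every matroid on fewer elements.  A CONJECTURE (data only); not
asserted here. -/
def HardRowIH (α : Type) [DecidableEq α] : Prop :=
  ∀ (q u : ℕ), 3 ≤ q → q < u → ∀ (N : Matroid α) [N.Finite], Simple' N → u + q + 1 ≤ (gr N).card →
    u + 1 ≤ rk N (gr N) → (∀ z ∈ gr N, ¬ GenericQ N z q) →
    (∀ (K : Matroid α) [K.Finite], (gr K).card < (gr N).card →
      ∀ q' u' : ℕ, q' < u' → ProfileIneqMinusQ K q' u') →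
    ProfileIneqMinusQ N q u

/-- The row form without the IH implies the row form with it. -/
theorem hardRowIH_of_hardRowQ'' (hrow : HardRowQ'' α) : HardRowIH α :=
  fun q u hq3 hqu N _ hs hn hR hgen _ => hrow q u hq3 hqu N hs hn hR hgen

/-- The co-rank-`q` row of every finite matroid from the IH-aware row form: p10's strong induction on `#E`
(the rows `q ≤ 2`, loops, parallel pairs, generic points, the levels `u ≥ ρ(E)`), the hypothesis receiving the
induction hypothesis on the hard class. -/
theorem profileIneqMinusQ_of_hardRowIH_aux (hrow : HardRowIH α) (n : ℕ) :
    ∀ (K : Matroid α) [K.Finite], (gr K).card = n → ∀ q u : ℕ, q < u → ProfileIneqMinusQ K q u := by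
  induction n using Nat.strong_induction_on with
  | _ n ih =>
    intro K _ hn q u hqu
    rcases Nat.lt_or_ge q 3 with hq3 | hq3
    · interval_cases q
      · exact profileIneqMinusQ_zero K u
      · exact profileIneqMinusQ_one_all K (by omega)
      · exact profileIneqMinusQ_two_all K u (by omega)
    have hq : 0 < q := by omega
    by_cases hsmall : (gr K).card ≤ u + q
    · exact profileIneqMinusQ_of_card_le hqu.le hsmall
    push Not at hsmall
    have hIH : ∀ z ∈ gr K, ProfileIneqMinusQ (K ＼ ({z} : Set α)) q u := by
      intro z hz
      have hcard : (gr (K ＼ ({z} : Set α))).card = n - 1 := by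
        rw [gr_delete', card_erase_of_mem hz, hn]
      have hlt : n - 1 < n := by
        have := card_pos.2 ⟨z, hz⟩
        omega
      exact ih (n - 1) hlt _ hcard q u hqu
    -- a loop
    by_cases hl : ∃ ℓ ∈ gr K, rk K {ℓ} = 0
    · obtain ⟨ℓ, hℓ, h0⟩ := hl
      exact profileIneqMinusQ_of_gapMonoQ (gapMonoQ_of_loop hℓ h0 (hIH ℓ hℓ)) (hIH ℓ hℓ)
    push Not at hl
    have h1 : ∀ x ∈ gr K, rk K {x} = 1 := by
      intro x hx
      have := rk_le_card (M := K) ({x} : Finset α)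
      rw [card_singleton] at this
      have := hl x hx
      omega
    -- a parallel pair
    by_cases hp : ∃ z ∈ gr K, ∃ z' ∈ gr K, z ≠ z' ∧ rk K {z, z'} = 1
    · obtain ⟨z, hz, z', hz', hzz', hpar⟩ := hp
      have hcard : (gr ((K ＼ ({z} : Set α)) ／ ({z'} : Set α))).card = n - 2 := by
        rw [gr_contract', gr_delete', card_erase_of_mem (mem_erase.2 ⟨Ne.symm hzz', hz'⟩), card_erase_of_mem hz, hn]
        omega
      have hlt : n - 2 < n := by
        have := card_pos.2 ⟨z, hz⟩
        omega
      have hdel := ih (n - 2) hlt _ hcard (q - 1) (u - 1) (by omega)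
      exact profileIneqMinusQ_of_gapMonoQ
        (gapMonoQ_of_parallel hz hz' hzz' (h1 z hz) (h1 z' hz') hpar hq hqu hdel) (hIH z hz)
    push Not at hp
    have h2 : ∀ x ∈ gr K, ∀ y ∈ gr K, x ≠ y → rk K {x, y} = 2 := by
      intro x hx y hy hxy
      have hle := rk_le_card (M := K) ({x, y} : Finset α)
      rw [card_pair hxy] at hle
      have hge : rk K {x} ≤ rk K {x, y} := rk_mono_sub (by simp)
      have hne := hp x hx y hy hxy
      have := h1 x hx
      omega
    have hs : Simple' K := simple'_of_rk_one_two h1 h2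
    -- a generic point
    by_cases hgen : ∃ z ∈ gr K, GenericQ K z q
    · obtain ⟨z, hz, hg⟩ := hgen
      have hzI : K.Indep {z} := by
        have h := indep_of_rk_eq_card (M := K) (X := {z}) (by rw [card_singleton]; exact h1 z hz)
        rwa [coe_singleton] at h
      have hcard : (gr (K ／ ({z} : Set α))).card = n - 1 := by
        rw [gr_contract', card_erase_of_mem hz, hn]
      have hlt : n - 1 < n := by
        have := card_pos.2 ⟨z, hz⟩
        omega
      have hdel := ih (n - 1) hlt _ hcard (q - 1) (u - 1) (by omega)
      exact profileIneqMinusQ_of_gapMonoQ (gapMonoQ_of_generic' hzI hq hqu hg hdel) (hIH z hz)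
    push Not at hgen
    -- the levels `u ≥ ρ(E)`
    by_cases hR1 : rk K (gr K) < u
    · exact profileIneqMinusQ_of_rk_lt hR1
    by_cases hR2 : rk K (gr K) = u
    · obtain ⟨z, hz⟩ : (gr K).Nonempty := card_pos.1 (by omega)
      have htop := gapMonoQ_top (M := K) (q := q) (by omega) z hz
      rw [hR2] at htop
      exact profileIneqMinusQ_of_gapMonoQ htop (hIH z hz)
    -- the row on the hard class, with the induction hypothesis
    exact hrow q u hq3 hqu K hs (by omega) (by omega) hgen
      (fun K' _ hlt q' u' hq'u' => ih _ (hn ▸ hlt) K' rfl q' u' hq'u')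

/-- The co-rank-`q` row of every finite matroid from the IH-aware row form. -/
theorem profileIneqMinusQ_of_hardRowIH (hrow : HardRowIH α) (K : Matroid α) [K.Finite] {q u : ℕ}
    (hqu : q < u) : ProfileIneqMinusQ K q u :=
  profileIneqMinusQ_of_hardRowIH_aux hrow _ K rfl q u hqu

/-- The plain row from the IH-aware row form. -/
theorem profileIneq_of_hardRowIH (hrow : HardRowIH α) (K : Matroid α) [K.Finite] {q u : ℕ}
    (hqu : q < u) : ProfileIneq K q u :=
  profileIneq_of_minusQ hqu.le (profileIneqMinusQ_of_hardRowIH hrow K hqu)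

/-- **The hard class after the coloop dispatch**: the IH-aware row form restricted to the hard matroids in which
every coloop `z` has `u + 1 ≤ ρ(N ∖ z) ≤ u + q − 1` (no coloop at the top-but-one level `ρ(N ∖ z) = u`, none in
the regime `ρ(N ∖ z) ≥ u + q`).  A CONJECTURE (data only); not asserted here. -/
def HardRowIHBand (α : Type) [DecidableEq α] : Prop :=
  ∀ (q u : ℕ), 3 ≤ q → q < u → ∀ (N : Matroid α) [N.Finite], Simple' N → u + q + 1 ≤ (gr N).card →
    u + 1 ≤ rk N (gr N) → (∀ z ∈ gr N, ¬ GenericQ N z q) →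
    (∀ z ∈ gr N, rk N ((gr N).erase z) + 1 = rk N (gr N) →
      u + 1 ≤ rk (N ＼ ({z} : Set α)) (gr (N ＼ ({z} : Set α))) ∧
        rk (N ＼ ({z} : Set α)) (gr (N ＼ ({z} : Set α))) ≤ u + q - 1) →
    (∀ (K : Matroid α) [K.Finite], (gr K).card < (gr N).card →
      ∀ q' u' : ℕ, q' < u' → ProfileIneqMinusQ K q' u') →
    ProfileIneqMinusQ N q u

/-- **THE COLOOP DISPATCH**: a hard matroid with a coloop `z` at the top-but-one level or in the regime
`ρ(N ∖ z) ≥ u + q` gets its row from the rows of `N ∖ z` (the induction hypothesis); so the band form of the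
hard rule implies the IH-aware row form. -/
theorem hardRowIH_of_band (hband : HardRowIHBand α) : HardRowIH α := by
  intro q u hq3 hqu N _ hs hn hR hgen hih
  by_cases hcol : ∀ z ∈ gr N, rk N ((gr N).erase z) + 1 = rk N (gr N) →
      u + 1 ≤ rk (N ＼ ({z} : Set α)) (gr (N ＼ ({z} : Set α))) ∧
        rk (N ＼ ({z} : Set α)) (gr (N ＼ ({z} : Set α))) ≤ u + q - 1
  · exact hband q u hq3 hqu N hs hn hR hgen hcol hih
  push Not at hcol
  obtain ⟨z, hz, hzc, hout⟩ := hcol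
  have hq : 1 ≤ q := by omega
  have hcard : (gr (N ＼ ({z} : Set α))).card < (gr N).card := by
    rw [gr_delete']
    exact card_erase_lt_of_mem hz
  have hrow := fun q' u' (h : q' < u') => hih (N ＼ ({z} : Set α)) hcard q' u' h
  -- the row `(q, u − 1)` of `N ∖ z`: the IH when `q < u − 1`, the level `u = q` theorem when `u − 1 = q`
  have hrow1 : ProfileIneqMinusQ (N ＼ ({z} : Set α)) q (u - 1) := by
    rcases Nat.lt_or_ge q (u - 1) with h | h
    · exact hrow q (u - 1) h
    · have : u - 1 = q := by omega
      rw [this]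
      exact profileIneqMinusQ_self _ q
  have hrk := rk_gr_delete_coloop (M := N) hzc
  by_cases htop : rk (N ＼ ({z} : Set α)) (gr (N ＼ ({z} : Set α))) = u
  · exact profileIneqMinusQ_of_coloop_top_but_one hz hzc hq hqu htop (hrow q u hqu) hrow1
  · have hreg : u + q ≤ rk (N ＼ ({z} : Set α)) (gr (N ＼ ({z} : Set α))) := by omega
    exact profileIneqMinusQ_of_coloop_regime hz hzc hq hqu hreg (hrow q u hqu) hrow1
      (hrow (q - 1) (u - 1) (by omega))

end PercRepro.Cogirth

namespace PercRepro

/-- **`C025Profile` FROM THE IH-AWARE ROW FORM OF THE HARD RULE.** -/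
theorem c025Profile_of_hardRowIH (h : ∀ (α : Type) [DecidableEq α], Cogirth.HardRowIH α) : C025Profile := by
  intro α _ M _ q u hqu
  exact Cogirth.profileIneq_of_hardRowIH (h α) M hqu

/-- **`C025` FROM THE IH-AWARE ROW FORM OF THE HARD RULE**: the co-rank-`q` row on the hard class, given every
row of every smaller matroid. -/
theorem c025_of_hardRowIH (h : ∀ (α : Type) [DecidableEq α], Cogirth.HardRowIH α) : C025 :=
  c025_of_profile (c025Profile_of_hardRowIH h)

/-- **`C025` FROM THE BAND FORM OF THE HARD RULE**: the hard class with its coloops confined to the band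
`u + 1 ≤ ρ(N ∖ z) ≤ u + q − 1`. -/
theorem c025_of_hardRowIHBand (h : ∀ (α : Type) [DecidableEq α], Cogirth.HardRowIHBand α) : C025 :=
  c025_of_hardRowIH (fun α _ => Cogirth.hardRowIH_of_band (h α))

end PercRepro
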